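import Literature.AnabelianGeometry.EtaleTheta.KummerDataYCoordFiltration
import Literature.AnabelianGeometry.EtaleTheta.SettingModelChiKummerDataNondeg
import HarnessLib

/-!
# The χ-twisted root model of [EtTh] §1 (R78 (B)): its `y`-coordinate KIT, and F6 recovered from the generic route

Mochizuki, *The étale theta function …*, Publ. RIMS **45** (2009) [EtTh], §1, Prop. 1.5, PRIMS PDF p. 23
[cite: MochizukiEtTh2009, Prop 1.5 p.23]: "`log(U) ∈ H¹(Π^tp_Y, Δ_Θ)`", "`log(Ü) = ½ · log(U)`", `F² ⥲ (K^×)^∧`,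
`F¹/F² = Ẑ · log(U)`.

CLASS (b) construction over the frozen interface (abc-iut cell, R78 cluster; seat abc-iut-w5-d181; no interface clause
touched): the FIRST INHABITANT of abc-iut-w5-d171's `ThetaSetting.YCoordKit` (`KummerDataYCoord.lean`, F6q prep) —
at abc-iut-L2-t1's χ-twisted root model `ThetaSetting.modelχ p` (stage 1):

* `SettingModel.yCoordKitχ p : (ThetaSetting.modelχ p).YCoordKit` — `χ^Θ := χ ∘ aug^Θ`, `ι := deltaThetaCoordχ`
  (`t ↦ c^t`, continuous, χ-equivariant, bijective), `ŷ := yThetaχ` (the descended `b`-exponent; a χ-crossed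
  homomorphism on ALL of `(Π^tp_X)^Θ` at stage 1, even on `(Π^tp_Ÿ)^Θ`);
* `yCoordKitχ_logU` / `yCoordKitχ_logUdd`: the kit's classes ARE the F6 classes `logUχ`, `logUddχ` of
  `SettingModelChiKummerData` — definitionally (`rfl`);
* the generic F²-results of `KummerDataYCoordFiltration` instantiated at the kit with the geometric element `b`
  (resp. `b²`): `yCoordKitχ_logU_not_mem_range_kumY`, `yCoordKitχ_zpowers_logU_inf_range_kumY`,
  `yCoordKitχ_logUdd_not_mem_range_kumYdd`, and `yCoordKitχ_res_deltaTheta_logU` (`log(U) ∈ F¹`) — the generic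
  route REPRODUCES the model-level file `SettingModelChiKummerDataFiltration` / w5-d171's `res_deltaTheta_logUχ`.

HONEST FRAMING: SEMI-SYNTHETIC model (split-Tate, stage 1) — consistency/non-vacuity evidence for the typed kit
interface only; nothing of [EtTh] is asserted; no new Prop fact; no side taken on [IUTchIII] Cor. 3.12.
-/

noncomputable section

open Topology

namespace Literature.AnabelianGeometry.EtaleTheta.SettingModel

open Literature.AnabelianGeometry.SemiGraphs

variable (p : ℕ) [Fact p.Prime]

/-- **The `y`-coordinate kit of the χ-twisted root model**: `χ^Θ = χ ∘ aug^Θ`, `ι = (t ↦ c^t) : Ẑ ⥲ Δ_Θ`,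
`ŷ = yThetaχ`. [cite: MochizukiEtTh2009, Prop 1.5 p.23] -/
def yCoordKitχ : (ThetaSetting.modelχ p).YCoordKit where
  chiT := (chi p).comp (CurveTheta.augTheta (curveχ p))
  iota := deltaThetaCoordχ p
  continuous_iota := continuous_deltaThetaCoordχ p
  iota_chiT g t := deltaThetaCoordχ_chi p g t
  y := yThetaχ p
  continuous_y := continuous_yThetaχ p
  y_mul g _ h _ := yThetaχ_mul p g h
  y_even _ hg := yThetaχ_mem_range_sqHom p hg

/-- **The kit's `log(U)` IS the F6 class `logUχ`** (definitionally). [cite: MochizukiEtTh2009, Prop 1.5 p.23] -/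
theorem yCoordKitχ_logU : (yCoordKitχ p).logU = logUχ p := rfl

/-- **The kit's `log(Ü)` IS the F6 class `logUddχ`** (definitionally). [cite: MochizukiEtTh2009, Prop 1.5 p.23] -/
theorem yCoordKitχ_logUdd : (yCoordKitχ p).logUdd = logUddχ p := rfl

/-- The F6 Kummer data ARE the Kummer data of the F6 core (definitionally). [cite: MochizukiEtTh2009, Prop 1.5 p.23] -/
theorem kummerDataχ_eq_toKummerData : kummerDataχ p = (kummerCoreχ p).toKummerData := rfl

/-! ### The geometric witnesses `b ∈ Δ^tp_Y`, `b² ∈ Δ^tp_Ÿ` in the shape the generic theorems consume -/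

/-- `aug^Θ(toTheta x) = 1` for a geometric `x = inl γ`. [cite: MochizukiEtTh2009, §1 p.12] -/
theorem augTheta_toTheta_inl (γ : Gfp) :
    (kummerCoreχ p).augTheta (CurveTheta.toTheta (curveχ p) (SemidirectProduct.inl γ)) = 1 := rfl

/-- The kit's `ŷ` is `yThetaχ` (definitionally). [cite: MochizukiEtTh2009, Prop 1.5 p.23] -/
theorem yCoordKitχ_y : (yCoordKitχ p).y = yThetaχ p := rfl

/-- The kit's `ι` is `deltaThetaCoordχ` (definitionally). [cite: MochizukiEtTh2009, §1 p.12] -/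
theorem yCoordKitχ_iota : (yCoordKitχ p).iota = deltaThetaCoordχ p := rfl

/-- The kit's `ι` is injective (`Ẑ ⥲ Δ_Θ`). [cite: MochizukiEtTh2009, §1 p.12] -/
theorem yCoordKitχ_iota_injective : Function.Injective (yCoordKitχ p).iota := by
  rw [yCoordKitχ_iota]
  exact (bijective_deltaThetaCoordχ p).1

/-- `ŷ(b^t) = t` on the theta quotient. [cite: MochizukiEtTh2009, Prop 1.5 p.23] -/
theorem yCoordKitχ_y_inl_bPowGfp (t : ZH) :
    (yCoordKitχ p).y (CurveTheta.toTheta (curveχ p) (SemidirectProduct.inl (bPowGfp t))) = t := by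
  rw [yCoordKitχ_y, yThetaχ_toTheta, yCoordχ_inl_bPowGfp]

/-- `ŷ` vanishes on `Δ_Θ = c^Ẑ`. [cite: MochizukiEtTh2009, Prop 1.5 p.23] -/
theorem yCoordKitχ_y_eq_one_of_mem_deltaTheta (d : (ThetaSetting.modelχ p).GtpTheta)
    (hd : d ∈ (ThetaSetting.modelχ p).DeltaTheta) : (yCoordKitχ p).y d = 1 := by
  obtain ⟨t, rfl⟩ := exists_cThetaχ_eq_of_mem_ker p hd
  rw [yCoordKitχ_y]
  exact yThetaχ_cThetaχ p t

/-! ### F6's filtration facts recovered from the GENERIC route -/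

/-- **`log(U) ∉ F²`** at the χ-model, via `YCoordKit.logU_not_mem_range_kumY` at `h := toTheta(inl b)`.
[cite: MochizukiEtTh2009, Prop 1.5 p.23] -/
theorem yCoordKitχ_logU_not_mem_range_kumY :
    (yCoordKitχ p).logU ∉ Set.range (kummerCoreχ p).toKummerData.kumY :=
  (yCoordKitχ p).logU_not_mem_range_kumY (kummerCoreχ p) (yCoordKitχ_iota_injective p)
    ⟨_, inl_bPowGfp_mem_gtpY p (iotaZ (Multiplicative.ofAdd 1)), rfl⟩ (augTheta_toTheta_inl p _)
    (conjNormal_toTheta_eq_self p (SemidirectProduct.right_inl _))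
    (by rw [yCoordKitχ_y_inl_bPowGfp]; exact iotaZ_ofAdd_ne_one one_ne_zero)

/-- **`log(U)^ℤ ∩ F² = 1`** at the χ-model, via `YCoordKit.zpowers_logU_inf_range_kumY`.
[cite: MochizukiEtTh2009, Prop 1.5 p.23] -/
theorem yCoordKitχ_zpowers_logU_inf_range_kumY :
    Subgroup.zpowers (yCoordKitχ p).logU ⊓ (kummerCoreχ p).toKummerData.kumY.range = ⊥ :=
  (yCoordKitχ p).zpowers_logU_inf_range_kumY (kummerCoreχ p) (yCoordKitχ_iota_injective p)
    ⟨_, inl_bPowGfp_mem_gtpY p (iotaZ (Multiplicative.ofAdd 1)), rfl⟩ (augTheta_toTheta_inl p _)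
    (conjNormal_toTheta_eq_self p (SemidirectProduct.right_inl _))
    (by rw [yCoordKitχ_y_inl_bPowGfp]; exact iotaZ_ofAdd_ne_one one_ne_zero)

/-- **`log(Ü) ∉ F̈²`** at the χ-model, via `YCoordKit.logUdd_not_mem_range_kumYdd` at `h := toTheta(inl b²)`.
[cite: MochizukiEtTh2009, Prop 1.5 p.23] -/
theorem yCoordKitχ_logUdd_not_mem_range_kumYdd :
    (yCoordKitχ p).logUdd ∉ Set.range (kummerCoreχ p).toKummerData.kumYdd :=
  (yCoordKitχ p).logUdd_not_mem_range_kumYdd (kummerCoreχ p) (yCoordKitχ_iota_injective p)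
    ⟨_, inl_bPowGfp_two_mem_gtpYdd p, rfl⟩ (augTheta_toTheta_inl p _)
    (conjNormal_toTheta_eq_self p (SemidirectProduct.right_inl _))
    (by rw [yCoordKitχ_y_inl_bPowGfp]; exact iotaZ_ofAdd_ne_one two_ne_zero)

/-- **`log(U) ∈ F¹`** at the χ-model, via `YCoordKit.res_deltaTheta_logU` (concordant with abc-iut-w5-d171's
`res_deltaTheta_logUχ`). [cite: MochizukiEtTh2009, Prop 1.5 p.23] -/
theorem yCoordKitχ_res_deltaTheta_logU :
    ContH1.res (MonoidHom.id (ThetaSetting.modelχ p).GtpTheta) (ThetaSetting.modelχ p).DeltaTheta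
      (deltaTheta_le_gtpY_map_modelχ p) (yCoordKitχ p).logU = 1 :=
  (yCoordKitχ p).res_deltaTheta_logU (deltaTheta_le_gtpY_map_modelχ p) (yCoordKitχ_y_eq_one_of_mem_deltaTheta p)

/-- The kit interface is inhabited at a setting with `IsEtThOrigin` (non-vacuity of `ThetaSetting.YCoordKit`).
[cite: MochizukiEtTh2009, Prop 1.5 p.23] -/
theorem exists_isEtThOrigin_and_nonempty_yCoordKit :
    ∃ D : ThetaSetting p, D.IsEtThOrigin ∧ Nonempty D.YCoordKit :=
  ⟨ThetaSetting.modelχ p, ThetaSetting.modelχ_isEtThOrigin p, ⟨yCoordKitχ p⟩⟩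

end Literature.AnabelianGeometry.EtaleTheta.SettingModel

end
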